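import Summits.HodgeConjecture.HodgeConjecture.Theorems.H413E2SWIdentityCloseCoreMarginal
import HarnessLib

/-!
# H413 · E-2 · SW2 (iii) — I-CLOSE at the split place on WEIGHTED MARGINALS (step (T2a) of the outer assembly)

Cell `hodgecm-mathlib`, crux H413 (`stmt-HodgeConjecture-24833`), child line `Cruxes/H413/Lines/F0_E2SiegelWeilWeilRange.lean` ED. 8,
stub `stub_SW2iii_siegelWeil`, identity half; pen sheet `F0/P4/F0P2a-p08/SW2-ICLOSE-ASSEMBLY.v0` §2 steps (1)–(4) in the WEIGHTED form
of F0P4-plan (g4)'s RULING «WEIGHTS» (2026-08-31T03:36:58Z): the factor `Y = X□(𝔸^{(v)})` of the split-place frame carries the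
archimedean places, so the comparison is tested against `𝟙_A ⊗ φ` with WEIGHTS `φ : Y → ℝ` bounded, measurable, compactly supported
(in the application `0 ≤ φ ∈ 𝒮_ℝ(Y)`), never against rectangles `𝟙_A ⊗ 𝟙_B`.  KERNEL MATHEMATICS ONLY (no definition, no `sorry`);
imports ★ `Theorems.H413E2SWIdentityCloseCoreMarginal` (B-p18) only.  HC_CM is proved only modulo the 7 printed citations until
rung 0 closes; nothing here is about Hodge classes.

THE STEP ([Weil1965] Chap. V n° 50, (39)–(40) p. 74, on «mesures tempérées»).  `K` a non-archimedean local field, `X_v = K^ι × K^ι` with the dual-pair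
action `(x, y) ↦ (g x, g⁻ᵀ y)` of `GL_ι(K)`, `Y` any topological measurable space; `μ₁, μ₂` measures on `X_v × Y`, finite on compact
rectangles, with `GL_ι(K)`-invariant rectangle masses (`hinv`) and carried by `S_{b′} × Y` (`hcar`), `S_{b′} = {x ⬝ᵥ y = b′, x ≠ 0, y ≠ 0}`.
For a weight `φ` as above the `φ`-WEIGHTED `X_v`-MARGINALS `m_i(A) := ∫_{A × Y} φ(y) dμ_i` — spelled `((μ_i.withDensity (φ ∘ snd)).map fst)`,
no new definition — are measures on `X_v`, finite on compacts (§1 `isFiniteMeasureOnCompacts_marginal`), `GL_ι(K)`-invariant (§1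
`marginal_eq_of_forall_prod`) and carried by `S_{b′}` (§1 `marginal_null_of_prod_null`); so ★ `measure_eq_smul_of_dilate_bound` (B-p18, the
`Y`-free I-CLOSE core: (J-v) twice + (CV-v)) applies as soon as the dilated-box masses obey `|m₁(D_n) − κ₀ m₂(D_n)| ≤ M ‖t_n‖^γ`,
`γ < |ι| − 1` — which is what (BOUND-b)∕COEFF-b deliver on the test functions `𝟙_{D_n} ⊗ φ` — and yields **`m₁ = κ₀ • m₂`** (§2
`marginal_eq_smul_marginal_of_dilate_bound`), i.e. `∫_{A × Y} φ dμ₁ = κ₀ ∫_{A × Y} φ dμ₂` for every measurable `A` (§2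
`setLIntegral_prod_univ_eq_smul_of_dilate_bound`).

References: A. Weil, *Sur la formule de Siegel dans la théorie des groupes classiques*, Acta Math. 113 (1965), Chap. V n° 49–50
(Lemme 22 p. 70; (39)–(40) p. 74), Chap. VI n° 51–52 (Théorème 5) pp. 75–77 [Weil1965].
-/

set_option autoImplicit false
-- the cell's `Summit.HodgeConjecture.HodgeConjecture.…` namespace repeats the summit name by design (D-0017 layout)
set_option linter.dupNamespace false

noncomputable section

open MeasureTheory Filter Topology Set
open scoped NNReal ENNReal Matrix
open Literature.NumberTheory.Automorphic Literature.NumberTheory.Weil1965.SplitPlace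
open Literature.NumberTheory.GaloisRepresentations.IsNonarchimedeanLocalField
open Summit.HodgeConjecture.HodgeConjecture.Cruxes.H413.E2SWIdentityCloseCore

namespace Summit.HodgeConjecture.HodgeConjecture.Cruxes.H413.E2SWIdentityCloseSplit

/-! ## §1 Weighted marginals (generic: any measurable `X`, `Y`) -/

section Marginal

variable {X Y : Type*} [MeasurableSpace X] [MeasurableSpace Y]

/-- the `φ`-weighted `X`-marginal of `μ` on a measurable `A`: `((μ.withDensity (φ ∘ snd)).map fst) A = ∫⁻_{A × Y} φ(y) dμ`. [folklore] -/
theorem marginal_apply (μ : Measure (X × Y)) (φ : Y → ℝ) {A : Set X} (hA : MeasurableSet A) :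
    ((μ.withDensity fun z => ENNReal.ofReal (φ z.2)).map Prod.fst) A = ∫⁻ z in A ×ˢ (univ : Set Y), ENNReal.ofReal (φ z.2) ∂μ := by
  rw [Measure.map_apply measurable_fst hA, withDensity_apply _ (measurable_fst hA), ← Set.prod_univ]

/-- the weighted rectangle mass as an integral over `Y` against the pushed restricted measure:
`∫⁻_{A × Y} φ(y) dμ = ∫⁻ φ d((μ|_{A × Y}).map snd)`. [folklore] -/
theorem setLIntegral_prod_univ_eq_lintegral_map_snd (μ : Measure (X × Y)) {φ : Y → ℝ} (hφ : Measurable φ) (A : Set X) :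
    ∫⁻ z in A ×ˢ (univ : Set Y), ENNReal.ofReal (φ z.2) ∂μ =
      ∫⁻ y, ENNReal.ofReal (φ y) ∂((μ.restrict (A ×ˢ (univ : Set Y))).map Prod.snd) := by
  rw [lintegral_map hφ.ennreal_ofReal measurable_snd]

/-- the pushed restricted measure on measurable sets: `((μ|_{A × Y}).map snd) B = μ (A × B)`. [folklore] -/
theorem map_snd_restrict_prod_univ_apply (μ : Measure (X × Y)) (A : Set X) {B : Set Y} (hB : MeasurableSet B) :
    ((μ.restrict (A ×ˢ (univ : Set Y))).map Prod.snd) B = μ (A ×ˢ B) := by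
  rw [Measure.map_apply measurable_snd hB, Measure.restrict_apply (measurable_snd hB), ← Set.univ_prod, Set.prod_inter_prod,
    Set.univ_inter, Set.inter_univ]

/-- **INVARIANCE TRANSFER to the weighted marginal**: if the rectangle masses of `μ` on `A′ × B` and `A × B` agree for every measurable
`B`, then the `φ`-weighted marginal masses of `A′` and `A` agree. [folklore] -/
theorem marginal_eq_of_forall_prod (μ : Measure (X × Y)) {φ : Y → ℝ} (hφ : Measurable φ) {A A' : Set X}
    (hA : MeasurableSet A) (hA' : MeasurableSet A')
    (h : ∀ B : Set Y, MeasurableSet B → μ (A' ×ˢ B) = μ (A ×ˢ B)) :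
    ((μ.withDensity fun z => ENNReal.ofReal (φ z.2)).map Prod.fst) A' =
      ((μ.withDensity fun z => ENNReal.ofReal (φ z.2)).map Prod.fst) A := by
  rw [marginal_apply μ φ hA', marginal_apply μ φ hA, setLIntegral_prod_univ_eq_lintegral_map_snd μ hφ,
    setLIntegral_prod_univ_eq_lintegral_map_snd μ hφ]
  congr 1
  exact Measure.ext fun B hB => by
    rw [map_snd_restrict_prod_univ_apply μ A' hB, map_snd_restrict_prod_univ_apply μ A hB, h B hB]

/-- **CARRIER TRANSFER**: if `μ (S × Y) = 0` then the weighted marginal of `S` vanishes. [folklore] -/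
theorem marginal_null_of_prod_null (μ : Measure (X × Y)) (φ : Y → ℝ) {S : Set X}
    (hS : MeasurableSet S) (h0 : μ (S ×ˢ (univ : Set Y)) = 0) :
    ((μ.withDensity fun z => ENNReal.ofReal (φ z.2)).map Prod.fst) S = 0 := by
  rw [marginal_apply μ φ hS]
  exact setLIntegral_measure_zero _ _ h0

end Marginal

section MarginalTop

/-- pointwise bound of the weight by a multiple of the indicator of its topological support. [folklore] -/
theorem ofReal_le_indicator_tsupport {Y : Type*} [TopologicalSpace Y] {φ : Y → ℝ} {C : ℝ} (hφC : ∀ y, φ y ≤ C) (y : Y) :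
    ENNReal.ofReal (φ y) ≤ (tsupport φ).indicator (fun _ => ENNReal.ofReal C) y := by
  by_cases hy : y ∈ tsupport φ
  · rw [Set.indicator_of_mem hy]
    exact ENNReal.ofReal_le_ofReal (hφC y)
  · rw [Set.indicator_of_notMem hy, image_eq_zero_of_notMem_tsupport hy, ENNReal.ofReal_zero]

variable {X Y : Type*} [TopologicalSpace X] [T2Space X] [MeasurableSpace X] [OpensMeasurableSpace X] [TopologicalSpace Y]
  [MeasurableSpace Y] [OpensMeasurableSpace Y]

/-- **FINITENESS ON COMPACTS of the weighted marginal** for a bounded weight `φ` and a measure `μ` finite on the rectangles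
`L × tsupport φ`, `L` compact (e.g. `φ` compactly supported and `μ` finite on compact rectangles). [folklore] -/
theorem isFiniteMeasureOnCompacts_marginal (μ : Measure (X × Y)) (φ : Y → ℝ) {C : ℝ}
    (hφC : ∀ y, φ y ≤ C)
    (hfin : ∀ L : Set X, IsCompact L → μ (L ×ˢ tsupport φ) < ⊤) :
    IsFiniteMeasureOnCompacts ((μ.withDensity fun z => ENNReal.ofReal (φ z.2)).map Prod.fst) := by
  refine ⟨fun L hL => ?_⟩
  rw [marginal_apply μ φ hL.measurableSet]
  have hT : MeasurableSet ((univ : Set X) ×ˢ tsupport φ) := MeasurableSet.univ.prod (isClosed_tsupport φ).measurableSet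
  calc ∫⁻ z in L ×ˢ (univ : Set Y), ENNReal.ofReal (φ z.2) ∂μ
      ≤ ∫⁻ z in L ×ˢ (univ : Set Y), ((univ : Set X) ×ˢ tsupport φ).indicator (fun _ => ENNReal.ofReal C) z ∂μ :=
        lintegral_mono fun z => by
          have h := ofReal_le_indicator_tsupport hφC z.2
          by_cases hz : z.2 ∈ tsupport φ
          · rw [Set.indicator_of_mem (Set.mk_mem_prod (Set.mem_univ _) hz)]
            rwa [Set.indicator_of_mem hz] at h
          · rw [Set.indicator_of_notMem hz] at h
            exact h.trans bot_le
    _ = ENNReal.ofReal C * μ (L ×ˢ tsupport φ) := by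
        rw [lintegral_indicator_const hT, Measure.restrict_apply hT, Set.prod_inter_prod, Set.univ_inter, Set.inter_univ]
    _ < ⊤ := ENNReal.mul_lt_top ENNReal.ofReal_lt_top (hfin L hL)

end MarginalTop

/-! ## §2 The split place: the `φ`-weighted marginals coincide up to `κ₀` -/

section SplitPlace

variable {K : Type*} [Field K] [ValuativeRel K] [TopologicalSpace K] [IsNonarchimedeanLocalField K]
variable {ι : Type*} [Fintype ι] [MeasurableSpace K] [BorelSpace K] (μK : Measure K) [μK.IsAddHaarMeasure]

/-- the split locus `S_b = {x ⬝ᵥ y = b, x ≠ 0, y ≠ 0}` is measurable. [folklore] -/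
theorem measurableSet_splitLocus [MeasurableSingletonClass K] (b : K) :
    MeasurableSet {z : (ι → K) × (ι → K) | z.1 ⬝ᵥ z.2 = b ∧ z.1 ≠ 0 ∧ z.2 ≠ 0} := by
  haveI : SecondCountableTopology K := secondCountableTopology_localField K
  have h1 : Measurable fun z : (ι → K) × (ι → K) => z.1 ⬝ᵥ z.2 :=
    (continuous_finsetSum _ fun i _ => ((continuous_apply i).comp continuous_fst).mul
      ((continuous_apply i).comp continuous_snd)).measurable
  have hset : {z : (ι → K) × (ι → K) | z.1 ⬝ᵥ z.2 = b ∧ z.1 ≠ 0 ∧ z.2 ≠ 0} =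
      ((fun z : (ι → K) × (ι → K) => z.1 ⬝ᵥ z.2) ⁻¹' {b}) ∩
        ({z : (ι → K) × (ι → K) | z.1 = 0}ᶜ ∩ {z : (ι → K) × (ι → K) | z.2 = 0}ᶜ) := by
    ext z
    simp only [Set.mem_setOf_eq, Set.mem_inter_iff, Set.mem_preimage, Set.mem_singleton_iff, Set.mem_compl_iff, ne_eq]
  rw [hset]
  exact (h1 (measurableSet_singleton b)).inter
    (((measurableSet_singleton (0 : ι → K)).preimage measurable_fst).compl.inter
      ((measurableSet_singleton (0 : ι → K)).preimage measurable_snd).compl)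

/-- the dual-pair action `(x, y) ↦ (g x, g⁻ᵀ y)` on `K^ι × K^ι` is measurable. [folklore] -/
theorem measurable_dualAct [DecidableEq ι] (g : GL ι K) :
    Measurable fun z : (ι → K) × (ι → K) =>
      ((((g : Matrix ι ι K) *ᵥ z.1, ((g⁻¹ : GL ι K) : Matrix ι ι K)ᵀ *ᵥ z.2) : (ι → K) × (ι → K))) := by
  haveI : SecondCountableTopology K := secondCountableTopology_localField K
  exact ((continuous_const.matrix_mulVec continuous_fst).prodMk (continuous_const.matrix_mulVec continuous_snd)).measurable

include μK in
/-- **I-CLOSE ON THE WEIGHTED MARGINALS.**  `|ι| ≥ 2`, `b : K`, `κ₀ : ℝ≥0`; `μ₁, μ₂` measures on `(K^ι × K^ι) × Y` finite on compact rectangles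
(`hfin₁`, `hfin₂`), with `GL_ι(K)`-invariant rectangle masses (`hinv₁`, `hinv₂`) and carried by `S_b × Y` (`hcar₁`, `hcar₂`); `φ : Y → ℝ` a bounded
measurable compactly supported weight.  If along a sequence `t n ∈ K`, `‖t n‖ → ∞`, the weighted dilated-box masses obey
`|∫_{D_n × Y} φ dμ₁ − κ₀ ∫_{D_n × Y} φ dμ₂| ≤ M ‖t n‖^γ` with `γ < |ι| − 1` (`hbd`; `D_n = {(t n)⁻¹x ∈ 𝒪^ι, y ∈ 𝒪^ι}`), then the `φ`-weighted
`X_v`-marginals coincide up to `κ₀`: `(μ₁.withDensity (φ∘snd)).map fst = κ₀ • (μ₂.withDensity (φ∘snd)).map fst` — ★ `measure_eq_smul_of_dilate_bound`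
on the marginals (§1 supplies its three hypotheses).  `μK` is any Haar measure on `K` (it fixes the reference fibre measure of the core).
[cite: Weil1965, Chap. V n° 50, (39)–(40), p. 74] [cite: Weil1965, Chap. V n° 49, Lemme 22, p. 70] -/
theorem marginal_eq_smul_marginal_of_dilate_bound [Nonempty ι] [DecidableEq ι] [MeasurableSingletonClass K]
    (hι : 2 ≤ Fintype.card ι) (b : K) (κ₀ : ℝ≥0)
    {Y : Type*} [TopologicalSpace Y] [MeasurableSpace Y] [OpensMeasurableSpace Y]
    (μ₁ μ₂ : Measure (((ι → K) × (ι → K)) × Y))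
    (hfin₁ : ∀ (L : Set ((ι → K) × (ι → K))) (T : Set Y), IsCompact L → IsCompact T → μ₁ (L ×ˢ T) < ⊤)
    (hfin₂ : ∀ (L : Set ((ι → K) × (ι → K))) (T : Set Y), IsCompact L → IsCompact T → μ₂ (L ×ˢ T) < ⊤)
    (hinv₁ : ∀ (g : GL ι K) (A : Set ((ι → K) × (ι → K))) (B : Set Y), MeasurableSet A → MeasurableSet B →
      μ₁ (((fun z => (((g : Matrix ι ι K) *ᵥ z.1, ((g⁻¹ : GL ι K) : Matrix ι ι K)ᵀ *ᵥ z.2) :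
        (ι → K) × (ι → K))) ⁻¹' A) ×ˢ B) = μ₁ (A ×ˢ B))
    (hinv₂ : ∀ (g : GL ι K) (A : Set ((ι → K) × (ι → K))) (B : Set Y), MeasurableSet A → MeasurableSet B →
      μ₂ (((fun z => (((g : Matrix ι ι K) *ᵥ z.1, ((g⁻¹ : GL ι K) : Matrix ι ι K)ᵀ *ᵥ z.2) :
        (ι → K) × (ι → K))) ⁻¹' A) ×ˢ B) = μ₂ (A ×ˢ B))
    (hcar₁ : μ₁ ({z : (ι → K) × (ι → K) | z.1 ⬝ᵥ z.2 = b ∧ z.1 ≠ 0 ∧ z.2 ≠ 0}ᶜ ×ˢ (univ : Set Y)) = 0)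
    (hcar₂ : μ₂ ({z : (ι → K) × (ι → K) | z.1 ⬝ᵥ z.2 = b ∧ z.1 ≠ 0 ∧ z.2 ≠ 0}ᶜ ×ˢ (univ : Set Y)) = 0)
    {φ : Y → ℝ} (hφ : Measurable φ) {C : ℝ} (hφC : ∀ y, φ y ≤ C) (hφs : HasCompactSupport φ)
    {t : ℕ → K} (ht0 : ∀ n, t n ≠ 0) (ht : Tendsto (fun n => (normAbs K (t n) : ℝ)) atTop atTop)
    {M γ : ℝ} (hγ : γ < (Fintype.card ι : ℝ) - 1)
    (hbd : ∀ n, |(∫⁻ z in {z : (ι → K) × (ι → K) | ((t n)⁻¹ • z.1, z.2) ∈ piPrimePowBall K ι 0 ×ˢ piPrimePowBall K ι 0} ×ˢ (univ : Set Y),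
          ENNReal.ofReal (φ z.2) ∂μ₁).toReal -
        (κ₀ : ℝ) * (∫⁻ z in {z : (ι → K) × (ι → K) | ((t n)⁻¹ • z.1, z.2) ∈ piPrimePowBall K ι 0 ×ˢ piPrimePowBall K ι 0} ×ˢ (univ : Set Y),
          ENNReal.ofReal (φ z.2) ∂μ₂).toReal| ≤ M * (normAbs K (t n) : ℝ) ^ γ) :
    (μ₁.withDensity fun z => ENNReal.ofReal (φ z.2)).map Prod.fst =
      κ₀ • (μ₂.withDensity fun z => ENNReal.ofReal (φ z.2)).map Prod.fst := by
  haveI : SecondCountableTopology K := secondCountableTopology_localField K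
  haveI : T2Space K := (isLocalField K).toT2Space
  haveI := isFiniteMeasureOnCompacts_marginal μ₁ φ hφC (fun L hL => hfin₁ L _ hL hφs.isCompact)
  haveI := isFiniteMeasureOnCompacts_marginal μ₂ φ hφC (fun L hL => hfin₂ L _ hL hφs.isCompact)
  have hS := measurableSet_splitLocus (ι := ι) b
  refine measure_eq_smul_of_dilate_bound μK hι b κ₀ _ _ (fun g A hA => ?_) ?_ (fun g A hA => ?_) ?_ ht0 ht (M := M) hγ (fun n => ?_)
  · exact marginal_eq_of_forall_prod μ₁ hφ hA (hA.preimage (measurable_dualAct g)) (fun B hB => hinv₁ g A B hA hB)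
  · exact marginal_null_of_prod_null μ₁ φ hS.compl hcar₁
  · exact marginal_eq_of_forall_prod μ₂ hφ hA (hA.preimage (measurable_dualAct g)) (fun B hB => hinv₂ g A B hA hB)
  · exact marginal_null_of_prod_null μ₂ φ hS.compl hcar₂
  · rw [marginal_apply μ₁ φ (measurableSet_dilateBox (t n)⁻¹), marginal_apply μ₂ φ (measurableSet_dilateBox (t n)⁻¹)]
    exact hbd n

include μK in
/-- **… hence the weighted rectangle masses agree up to `κ₀` on EVERY measurable `A`**:
`∫⁻_{A × Y} φ dμ₁ = κ₀ · ∫⁻_{A × Y} φ dμ₂`. [cite: Weil1965, Chap. V n° 50, (39)–(40), p. 74] -/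
theorem setLIntegral_prod_univ_eq_smul_of_dilate_bound [Nonempty ι] [DecidableEq ι] [MeasurableSingletonClass K]
    (hι : 2 ≤ Fintype.card ι) (b : K) (κ₀ : ℝ≥0)
    {Y : Type*} [TopologicalSpace Y] [MeasurableSpace Y] [OpensMeasurableSpace Y]
    (μ₁ μ₂ : Measure (((ι → K) × (ι → K)) × Y))
    (hfin₁ : ∀ (L : Set ((ι → K) × (ι → K))) (T : Set Y), IsCompact L → IsCompact T → μ₁ (L ×ˢ T) < ⊤)
    (hfin₂ : ∀ (L : Set ((ι → K) × (ι → K))) (T : Set Y), IsCompact L → IsCompact T → μ₂ (L ×ˢ T) < ⊤)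
    (hinv₁ : ∀ (g : GL ι K) (A : Set ((ι → K) × (ι → K))) (B : Set Y), MeasurableSet A → MeasurableSet B →
      μ₁ (((fun z => (((g : Matrix ι ι K) *ᵥ z.1, ((g⁻¹ : GL ι K) : Matrix ι ι K)ᵀ *ᵥ z.2) :
        (ι → K) × (ι → K))) ⁻¹' A) ×ˢ B) = μ₁ (A ×ˢ B))
    (hinv₂ : ∀ (g : GL ι K) (A : Set ((ι → K) × (ι → K))) (B : Set Y), MeasurableSet A → MeasurableSet B →
      μ₂ (((fun z => (((g : Matrix ι ι K) *ᵥ z.1, ((g⁻¹ : GL ι K) : Matrix ι ι K)ᵀ *ᵥ z.2) :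
        (ι → K) × (ι → K))) ⁻¹' A) ×ˢ B) = μ₂ (A ×ˢ B))
    (hcar₁ : μ₁ ({z : (ι → K) × (ι → K) | z.1 ⬝ᵥ z.2 = b ∧ z.1 ≠ 0 ∧ z.2 ≠ 0}ᶜ ×ˢ (univ : Set Y)) = 0)
    (hcar₂ : μ₂ ({z : (ι → K) × (ι → K) | z.1 ⬝ᵥ z.2 = b ∧ z.1 ≠ 0 ∧ z.2 ≠ 0}ᶜ ×ˢ (univ : Set Y)) = 0)
    {φ : Y → ℝ} (hφ : Measurable φ) {C : ℝ} (hφC : ∀ y, φ y ≤ C) (hφs : HasCompactSupport φ)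
    {t : ℕ → K} (ht0 : ∀ n, t n ≠ 0) (ht : Tendsto (fun n => (normAbs K (t n) : ℝ)) atTop atTop)
    {M γ : ℝ} (hγ : γ < (Fintype.card ι : ℝ) - 1)
    (hbd : ∀ n, |(∫⁻ z in {z : (ι → K) × (ι → K) | ((t n)⁻¹ • z.1, z.2) ∈ piPrimePowBall K ι 0 ×ˢ piPrimePowBall K ι 0} ×ˢ (univ : Set Y),
          ENNReal.ofReal (φ z.2) ∂μ₁).toReal -
        (κ₀ : ℝ) * (∫⁻ z in {z : (ι → K) × (ι → K) | ((t n)⁻¹ • z.1, z.2) ∈ piPrimePowBall K ι 0 ×ˢ piPrimePowBall K ι 0} ×ˢ (univ : Set Y),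
          ENNReal.ofReal (φ z.2) ∂μ₂).toReal| ≤ M * (normAbs K (t n) : ℝ) ^ γ)
    {A : Set ((ι → K) × (ι → K))} (hA : MeasurableSet A) :
    ∫⁻ z in A ×ˢ (univ : Set Y), ENNReal.ofReal (φ z.2) ∂μ₁ = κ₀ * ∫⁻ z in A ×ˢ (univ : Set Y), ENNReal.ofReal (φ z.2) ∂μ₂ := by
  have h := marginal_eq_smul_marginal_of_dilate_bound μK hι b κ₀ μ₁ μ₂ hfin₁ hfin₂ hinv₁ hinv₂ hcar₁ hcar₂ hφ hφC hφs ht0 ht hγ hbd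
  have hA' := congrArg (fun m : Measure ((ι → K) × (ι → K)) => m A) h
  simp only [Measure.smul_apply, ENNReal.smul_def, smul_eq_mul] at hA'
  rwa [marginal_apply μ₁ φ hA, marginal_apply μ₂ φ hA] at hA'

end SplitPlace

end Summit.HodgeConjecture.HodgeConjecture.Cruxes.H413.E2SWIdentityCloseSplit

end
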